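import Mathlib
import Summits.MatrixMultiplication.MatrixMultiplication.Theorems.SnSubsetDichotomyHyperoctahedralThresholdStubSameColourSupply

/-!
# Mutual defects of half-clean, S-free same-colour structures (crux `HyperoctahedralThreshold`, open core `stub_poorRigidCore`; siege k9)

Brick 4′ of the dart-level bookkeeping (memo `memo-k9-dart-bookkeeping.md`, evidence on stmt-MatrixMultiplication-10883): the
forbidden-set refinement of the sibling `…MutualDefects` (p117140).  The members of the family avoid a set `S` at all their points, and
the configuration containers `Cpp`, `Cpq` are only required to contain tuples whose coincidence point `P` lies OUTSIDE `S` — this is what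
makes dart-level excision usable downstream (take `S ⊇ R ∪ {hot points}`: the tuples to be counted then have non-hot `P`, memo §2 (B5)),
whereas adding the tuples with `P ∈ S` to the containers would cost `|S|·2^{2h}`, unaffordable at the top scale.  Statement and proof
are otherwise those of p117140 (the injections land at `P` = a trajectory point of the member, hence outside `S`).
A same-colour structure `(a, G)` of colour `c` and length `2h` (`μ c (a·G) = (μ c a)·G`) is HALF-CLEAN when any two of its rungs
`(a·G_[t], (μ c a)·G_[t])` at positions both `≤ h`, or both `≥ h`, are equal, swapped or disjoint — the property inherited from
self-clean darts (`…GoodStructureSupply`).  Such a structure is either CLEAN (all rung pairs), or it has a MUTUAL defect: a rung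
`s < h` of the first half and a rung `2h - τ`, `τ < h`, of the second half sharing exactly one point, `(s, τ) ≠ (0, 0)` (the two end
rungs are `c`-edges — no tips).  Writing `α = G_[s]`, `x = G_(s,h]`, and `α' = g₂_[τ]`, `x' = g₂_(τ,h]` for the second dart
`g₂ = (G.drop h)⁻¹`, the coincidence point `P` satisfies (memo §3 (∗))

* `P·x = P·x'` and `(P·ι_α)·x = (P·ι_{α'})·x'` (types pp, qq), or
* `P·x = (P·ι_{α'})·x'` and `(P·ι_α)·x = P·x'` (types pq, qp),

where `P·ι_α := P·α⁻¹·c·α` is the reflection partner.  `card_le_clean_add_mutual` / `stub_mutualDefects`: the half-clean structures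
of a finite family number at most the clean ones plus `Σ_{s,τ<h, (s,τ)≠(0,0)} 2(|Cpp(s,τ)| + |Cpq(s,τ)|)` for any sets `Cpp`, `Cpq`
containing the configuration tuples `(P, α, α', x, x')` above.  This is the dart-level refinement of lead c3's
`stub_reflectionDefects` (p114312): only cross-half positions occur, and the tuples are the ones the closed-walk density (NT) and the
hot-rung excision of the memo bound — except in the corner `s, τ < s₁`.

Pure finite combinatorics; no definitions; reuses `foldl_act_reverse`, `foldl_act_injective`, `mem_words` (p112303).
-/

set_option linter.dupNamespace false

namespace Summit.MatrixMultiplication.MatrixMultiplication.Theorems.HyperoctahedralThreshold.MutualDefectsAvoiding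

open Finset
open Summit.MatrixMultiplication.MatrixMultiplication.Theorems.HyperoctahedralThreshold.Supply

variable {n : ℕ}

/-! ### The decomposition -/

/-- **Half-clean `S`-free structures: clean, or a mutual defect off `S`.**  Let `T` be a finite family of same-colour structures `(a, G)`
of colour `c` and length `2h`, each HALF-CLEAN and avoiding `S` at all its points.  Then `|T| ≤ |T ∩ clean| + Σ_{s<h} Σ_{τ<h} [¬(s = 0 ∧ τ = 0)] · 2(|Cpp s τ| + |Cpq s τ|)`
for any predicate `clean` implied by cleanness of all rung pairs and any sets `Cpp s τ ⊇ {(P,α,α',x,x') : P·x = P·x', (P·ι_α)·x =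
(P·ι_{α'})·x'}`, `Cpq s τ ⊇ {(P,α,α',x,x') : P·x = (P·ι_{α'})·x', (P·ι_α)·x = P·x'}` over reduced words of lengths `s, τ, h-s, h-τ`.
Proof: an unclean member has a non-allowed rung pair `(s₀, t₀)`; by half-cleanness `s₀ < h < t₀` (up to order), and `(s₀, t₀) ≠
(0, 2h)` because the end rungs are `c`-edges; one of the four coincidences holds, and each coincidence type at `(s, τ) = (s₀, 2h - t₀)`
injects into `Cpp` or `Cpq` by `(a, G) ↦ (P, G_[s], g₂_[τ], G_(s,h], g₂_(τ,h])` with `P` the `p`- or the `q`-point at position `s`. -/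
theorem card_le_clean_add_mutual_avoiding (μ : Fin 3 → Equiv.Perm (Fin n)) (c : Fin 3) (hμ : ∀ b, μ b * μ b = 1) (h : ℕ)
    (S : Finset (Fin n))
    (red : ℕ → Finset (List (Fin 3))) (hred : ∀ m w, w.length = m → List.IsChain (· ≠ ·) w → w ∈ red m)
    (T : Finset (Fin n × List (Fin 3)))
    (hT : ∀ p ∈ T, p.2.length = 2 * h ∧ List.IsChain (· ≠ ·) p.2 ∧
      μ c (p.2.foldl (fun v b => μ b v) p.1) = p.2.foldl (fun v b => μ b v) (μ c p.1) ∧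
      (∀ t ∈ Finset.range (2 * h + 1), (p.2.take t).foldl (fun v b => μ b v) p.1 ∉ S ∧
        (p.2.take t).foldl (fun v b => μ b v) (μ c p.1) ∉ S) ∧ (∀ s ∈ Finset.range (h + 1), ∀ t ∈ Finset.range (h + 1), ((((p.2).take s).foldl (fun v b => μ b v) p.1 = ((p.2).take t).foldl (fun v b => μ b v) p.1 ∧ ((p.2).take s).foldl (fun v b => μ b v) (μ c p.1) = ((p.2).take t).foldl (fun v b => μ b v) (μ c p.1)) ∨ (((p.2).take s).foldl (fun v b => μ b v) p.1 = ((p.2).take t).foldl (fun v b => μ b v) (μ c p.1) ∧ ((p.2).take s).foldl (fun v b => μ b v) (μ c p.1) = ((p.2).take t).foldl (fun v b => μ b v) p.1) ∨ (((p.2).take s).foldl (fun v b => μ b v) p.1 ≠ ((p.2).take t).foldl (fun v b => μ b v) p.1 ∧ ((p.2).take s).foldl (fun v b => μ b v) p.1 ≠ ((p.2).take t).foldl (fun v b => μ b v) (μ c p.1) ∧ ((p.2).take s).foldl (fun v b => μ b v) (μ c p.1) ≠ ((p.2).take t).foldl (fun v b => μ b v) p.1 ∧ ((p.2).take s).foldl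 (fun v b => μ b v) (μ c p.1) ≠ ((p.2).take t).foldl (fun v b => μ b v) (μ c p.1)))) ∧ (∀ s ∈ Finset.range (h + 1), ∀ t ∈ Finset.range (h + 1), ((((p.2).take (h + s)).foldl (fun v b => μ b v) p.1 = ((p.2).take (h + t)).foldl (fun v b => μ b v) p.1 ∧ ((p.2).take (h + s)).foldl (fun v b => μ b v) (μ c p.1) = ((p.2).take (h + t)).foldl (fun v b => μ b v) (μ c p.1)) ∨ (((p.2).take (h + s)).foldl (fun v b => μ b v) p.1 = ((p.2).take (h + t)).foldl (fun v b => μ b v) (μ c p.1) ∧ ((p.2).take (h + s)).foldl (fun v b => μ b v) (μ c p.1) = ((p.2).take (h + t)).foldl (fun v b => μ b v) p.1) ∨ (((p.2).take (h + s)).foldl (fun v b => μ b v) p.1 ≠ ((p.2).take (h + t)).foldl (fun v b => μ b v) p.1 ∧ ((p.2).take (h + s)).foldl (fun v b => μ b v) p.1 ≠ ((p.2).take (h + t)).foldl (fun v b => μ b v) (μ c p.1) ∧ ((p.2).take (h + s)).foldl (fun v b => μ b v) (μ c p.1) ≠ ((p.2).take (h + t)).foldl (fun v b => μ b v) p.1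 ∧ ((p.2).take (h + s)).foldl (fun v b => μ b v) (μ c p.1) ≠ ((p.2).take (h + t)).foldl (fun v b => μ b v) (μ c p.1)))))
    (clean : Fin n × List (Fin 3) → Prop) [DecidablePred clean]
    (hclean : ∀ p : Fin n × List (Fin 3), (∀ s ∈ Finset.range (2 * h + 1), ∀ t ∈ Finset.range (2 * h + 1), ((((p.2).take s).foldl (fun v b => μ b v) p.1 = ((p.2).take t).foldl (fun v b => μ b v) p.1 ∧ ((p.2).take s).foldl (fun v b => μ b v) (μ c p.1) = ((p.2).take t).foldl (fun v b => μ b v) (μ c p.1)) ∨ (((p.2).take s).foldl (fun v b => μ b v) p.1 = ((p.2).take t).foldl (fun v b => μ b v) (μ c p.1) ∧ ((p.2).take s).foldl (fun v b => μ b v) (μ c p.1) = ((p.2).take t).foldl (fun v b => μ b v) p.1) ∨ (((p.2).take s).foldl (fun v b => μ b v) p.1 ≠ ((p.2).take t).foldl (fun v b => μ b v) p.1 ∧ ((p.2).take s).foldl (fun v b => μ b v) p.1 ≠ ((p.2).take t).foldl (fun v b => μ b v) (μ c p.1) ∧ ((p.2).take s).foldl (fun v b => μ b v) (μ c p.1)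 ≠ ((p.2).take t).foldl (fun v b => μ b v) p.1 ∧ ((p.2).take s).foldl (fun v b => μ b v) (μ c p.1) ≠ ((p.2).take t).foldl (fun v b => μ b v) (μ c p.1)))) → clean p)
    (Cpp Cpq : ℕ → ℕ → Finset (Fin n × List (Fin 3) × List (Fin 3) × List (Fin 3) × List (Fin 3)))
    (hCpp : ∀ (s τ : ℕ) (P : Fin n) (α α' x x' : List (Fin 3)), P ∉ S → α ∈ red s → α' ∈ red τ → x ∈ red (h - s) →
      x' ∈ red (h - τ) → x.foldl (fun v b => μ b v) P = x'.foldl (fun v b => μ b v) P →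
      x.foldl (fun v b => μ b v) (((α).reverse ++ c :: α).foldl (fun v b => μ b v) P) = x'.foldl (fun v b => μ b v) (((α').reverse ++ c :: α').foldl (fun v b => μ b v) P) →
      (P, α, α', x, x') ∈ Cpp s τ)
    (hCpq : ∀ (s τ : ℕ) (P : Fin n) (α α' x x' : List (Fin 3)), P ∉ S → α ∈ red s → α' ∈ red τ → x ∈ red (h - s) →
      x' ∈ red (h - τ) → x.foldl (fun v b => μ b v) P = x'.foldl (fun v b => μ b v) (((α').reverse ++ c :: α').foldl (fun v b => μ b v) P) →
      x.foldl (fun v b => μ b v) (((α).reverse ++ c :: α).foldl (fun v b => μ b v) P) = x'.foldl (fun v b => μ b v) P →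
      (P, α, α', x, x') ∈ Cpq s τ) :
    T.card ≤ (T.filter clean).card + ∑ s ∈ Finset.range h, ∑ τ ∈ Finset.range h,
      (if s = 0 ∧ τ = 0 then 0 else 2 * ((Cpp s τ).card + (Cpq s τ).card)) := by
  -- trajectory identities (local copies of the `…MutualDefects` lemmas, p117140)
  have foldl_take_two_mul_sub : ∀ {τ : ℕ} {G : List (Fin 3)}, G.length = 2 * h → τ ≤ h → ∀ x : Fin n,
      (G.take (2 * h - τ)).foldl (fun v b => μ b v) x = (((G.drop h).reverse).take τ).foldl (fun v b => μ b v) (G.foldl (fun v b => μ b v) x) := by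
    intro τ G hl hτ x
    have hg : G = G.take h ++ G.drop h := (List.take_append_drop h G).symm
    have hlA : (G.take h).length = h := by rw [List.length_take]; omega
    have hlB : (G.drop h).length = h := by rw [List.length_drop]; omega
    have h1 : G.take (2 * h - τ) = G.take h ++ (G.drop h).take (h - τ) := by
      conv_lhs => rw [hg]
      rw [List.take_append, List.take_of_length_le (show (G.take h).length ≤ 2 * h - τ by omega), hlA,
        show 2 * h - τ - h = h - τ by omega]
    have h2 : (G.drop h).reverse.take τ = ((G.drop h).drop (h - τ)).reverse := by
      rw [List.take_reverse, hlB]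
    have h3 : G.foldl (fun v b => μ b v) x =
        ((G.drop h).drop (h - τ)).foldl (fun v b => μ b v) (((G.drop h).take (h - τ)).foldl (fun v b => μ b v) ((G.take h).foldl (fun v b => μ b v) x)) := by
      rw [← List.foldl_append, List.take_append_drop, ← List.foldl_append, ← hg]
    rw [h1, h2, List.foldl_append, h3, foldl_act_reverse μ hμ]
  have foldl_first_half : ∀ {s : ℕ} {G : List (Fin 3)}, s ≤ h → ∀ y : Fin n,
      ((G.take h).drop s).foldl (fun v b => μ b v) ((G.take s).foldl (fun v b => μ b v) y) = (G.take h).foldl (fun v b => μ b v) y := by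
    intro s G hs y
    have e : G.take s = (G.take h).take s := by rw [List.take_take, Nat.min_eq_left hs]
    rw [e, ← List.foldl_append, List.take_append_drop]
  have foldl_second_half : ∀ {τ : ℕ} {G : List (Fin 3)} (y : Fin n),
      (((G.drop h).reverse).drop τ).foldl (fun v b => μ b v) ((((G.drop h).reverse).take τ).foldl (fun v b => μ b v) (G.foldl (fun v b => μ b v) y)) =
        (G.take h).foldl (fun v b => μ b v) y := by
    intro τ G y
    rw [← List.foldl_append, List.take_append_drop]
    have hG : G.foldl (fun v b => μ b v) y = (G.drop h).foldl (fun v b => μ b v) ((G.take h).foldl (fun v b => μ b v) y) := by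
      rw [← List.foldl_append, List.take_append_drop]
    rw [hG, foldl_act_reverse μ hμ]
  have foldl_refl : ∀ (α : List (Fin 3)) (y : Fin n),
      (α.reverse ++ c :: α).foldl (fun v b => μ b v) (α.foldl (fun v b => μ b v) y) = α.foldl (fun v b => μ b v) (μ c y) := by
    intro α y
    rw [List.foldl_append, foldl_act_reverse μ hμ, List.foldl_cons]
  have reconstruct : ∀ {s : ℕ} (τ : ℕ) {G : List (Fin 3)}, s ≤ h →
      (G.take s ++ (G.take h).drop s) ++ ((((G.drop h).reverse).take τ) ++ (((G.drop h).reverse).drop τ)).reverse = G := by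
    intro s τ G hs
    have e : G.take s = (G.take h).take s := by rw [List.take_take, Nat.min_eq_left hs]
    rw [e, List.take_append_drop, List.take_append_drop, List.reverse_reverse, List.take_append_drop]
  have apply_apply : ∀ y : Fin n, μ c (μ c y) = y := fun y => by
    have h : (μ c * μ c) y = y := by rw [hμ c]; rfl
    simpa using h
  -- the two extraction maps: `P` is the `p`-point (`Fp`) or the `q`-point (`Fq`) of the first half at position `s`
  set Fp : ℕ → ℕ → Fin n × List (Fin 3) → Fin n × List (Fin 3) × List (Fin 3) × List (Fin 3) × List (Fin 3) :=
    fun s τ p => ((p.2.take s).foldl (fun v b => μ b v) p.1, p.2.take s, ((p.2.drop h).reverse).take τ, (p.2.take h).drop s,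
      ((p.2.drop h).reverse).drop τ) with hFp
  set Fq : ℕ → ℕ → Fin n × List (Fin 3) → Fin n × List (Fin 3) × List (Fin 3) × List (Fin 3) × List (Fin 3) :=
    fun s τ p => ((p.2.take s).foldl (fun v b => μ b v) (μ c p.1), p.2.take s, ((p.2.drop h).reverse).take τ, (p.2.take h).drop s,
      ((p.2.drop h).reverse).drop τ) with hFq
  -- both are injective on `T` (indeed on all pairs)
  have hinjp : ∀ s τ, s ≤ h → Set.InjOn (Fp s τ) ↑T := by
    intro s τ hs p _ p' _ hpp
    simp only [hFp, Prod.mk.injEq] at hpp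
    obtain ⟨h1, h2, h3, h4, h5⟩ := hpp
    have hG : p.2 = p'.2 := by
      rw [← reconstruct τ hs (G := p.2), ← reconstruct τ hs (G := p'.2), h2, h3, h4, h5]
    refine Prod.ext ?_ hG
    rw [h2] at h1
    exact foldl_act_injective μ hμ _ h1
  have hinjq : ∀ s τ, s ≤ h → Set.InjOn (Fq s τ) ↑T := by
    intro s τ hs p _ p' _ hpp
    simp only [hFq, Prod.mk.injEq] at hpp
    obtain ⟨h1, h2, h3, h4, h5⟩ := hpp
    have hG : p.2 = p'.2 := by
      rw [← reconstruct τ hs (G := p.2), ← reconstruct τ hs (G := p'.2), h2, h3, h4, h5]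
    refine Prod.ext ?_ hG
    rw [h2] at h1
    exact (μ c).injective (foldl_act_injective μ hμ _ h1)
  -- the four defect families at `(s, τ)`
  set Dpp : ℕ × ℕ → Finset (Fin n × List (Fin 3)) := fun st => T.filter (fun p =>
    (p.2.take st.1).foldl (fun v b => μ b v) p.1 = (p.2.take (2 * h - st.2)).foldl (fun v b => μ b v) p.1) with hDpp
  set Dqq : ℕ × ℕ → Finset (Fin n × List (Fin 3)) := fun st => T.filter (fun p =>
    (p.2.take st.1).foldl (fun v b => μ b v) (μ c p.1) = (p.2.take (2 * h - st.2)).foldl (fun v b => μ b v) (μ c p.1)) with hDqq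
  set Dpq : ℕ × ℕ → Finset (Fin n × List (Fin 3)) := fun st => T.filter (fun p =>
    (p.2.take st.1).foldl (fun v b => μ b v) p.1 = (p.2.take (2 * h - st.2)).foldl (fun v b => μ b v) (μ c p.1)) with hDpq
  set Dqp : ℕ × ℕ → Finset (Fin n × List (Fin 3)) := fun st => T.filter (fun p =>
    (p.2.take st.1).foldl (fun v b => μ b v) (μ c p.1) = (p.2.take (2 * h - st.2)).foldl (fun v b => μ b v) p.1) with hDqp
  -- pieces of a member of `T`
  have pieces : ∀ p ∈ T, ∀ s τ, s ≤ h → τ ≤ h →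
      p.2.take s ∈ red s ∧ ((p.2.drop h).reverse).take τ ∈ red τ ∧ (p.2.take h).drop s ∈ red (h - s) ∧
      ((p.2.drop h).reverse).drop τ ∈ red (h - τ) := by
    intro p hp s τ hs hτ
    obtain ⟨hl, hch, -, -, -, -⟩ := hT p hp
    have hrev : List.IsChain (· ≠ ·) (p.2.drop h).reverse := by
      rw [List.isChain_reverse]
      exact (hch.drop h).imp (fun a b hab => Ne.symm hab)
    refine ⟨hred _ _ ?_ (hch.take s), hred _ _ ?_ (hrev.take τ), hred _ _ ?_ ((hch.take h).drop s),
      hred _ _ ?_ (hrev.drop τ)⟩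
    · rw [List.length_take]; omega
    · rw [List.length_take, List.length_reverse, List.length_drop]; omega
    · rw [List.length_drop, List.length_take]; omega
    · rw [List.length_drop, List.length_reverse, List.length_drop]; omega
  -- the four families inject into the configuration sets
  have key : ∀ p ∈ T, ∀ s τ, s ≤ h → τ ≤ h → ∀ y : Fin n,
      ((p.2.take h).drop s).foldl (fun v b => μ b v) ((p.2.take s).foldl (fun v b => μ b v) y) = (p.2.take h).foldl (fun v b => μ b v) y ∧
      (((p.2.drop h).reverse).drop τ).foldl (fun v b => μ b v) ((((p.2.drop h).reverse).take τ).foldl (fun v b => μ b v) (p.2.foldl (fun v b => μ b v) y)) =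
        (p.2.take h).foldl (fun v b => μ b v) y ∧
      (p.2.take (2 * h - τ)).foldl (fun v b => μ b v) y = (((p.2.drop h).reverse).take τ).foldl (fun v b => μ b v) (p.2.foldl (fun v b => μ b v) y) := by
    intro p hp s τ hs hτ y
    obtain ⟨hl, -, -, -, -, -⟩ := hT p hp
    exact ⟨foldl_first_half hs y, foldl_second_half y, foldl_take_two_mul_sub hl hτ y⟩
  have hmaps_pp : ∀ s τ, s ≤ h → τ ≤ h → Set.MapsTo (Fp s τ) ↑(Dpp (s, τ)) ↑(Cpp s τ) := by
    intro s τ hs hτ p hp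
    rw [Finset.mem_coe, hDpp, Finset.mem_filter] at hp
    obtain ⟨hpT, he⟩ := hp
    obtain ⟨-, -, hstr, hS, -, -⟩ := hT p hpT
    obtain ⟨r1, r2, r3, r4⟩ := pieces p hpT s τ hs hτ
    obtain ⟨A1, A2, A3⟩ := key p hpT s τ hs hτ p.1
    obtain ⟨B1, B2, B3⟩ := key p hpT s τ hs hτ (μ c p.1)
    refine hCpp s τ _ _ _ _ _ ?_ r1 r2 r3 r4 ?_ ?_
    · exact (hS s (Finset.mem_range.2 (by omega))).1
    · rw [A1, he, A3, A2]
    · rw [foldl_refl, B1, he, A3, foldl_refl, hstr, B2]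
  have hmaps_qq : ∀ s τ, s ≤ h → τ ≤ h → Set.MapsTo (Fq s τ) ↑(Dqq (s, τ)) ↑(Cpp s τ) := by
    intro s τ hs hτ p hp
    rw [Finset.mem_coe, hDqq, Finset.mem_filter] at hp
    obtain ⟨hpT, he⟩ := hp
    obtain ⟨-, -, hstr, hS, -, -⟩ := hT p hpT
    have hstr' : μ c (p.2.foldl (fun v b => μ b v) (μ c p.1)) = p.2.foldl (fun v b => μ b v) p.1 := by
      rw [← hstr, apply_apply]
    obtain ⟨r1, r2, r3, r4⟩ := pieces p hpT s τ hs hτ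
    obtain ⟨A1, A2, A3⟩ := key p hpT s τ hs hτ p.1
    obtain ⟨B1, B2, B3⟩ := key p hpT s τ hs hτ (μ c p.1)
    refine hCpp s τ _ _ _ _ _ ?_ r1 r2 r3 r4 ?_ ?_
    · exact (hS s (Finset.mem_range.2 (by omega))).2
    · rw [B1, he, B3, B2]
    · rw [foldl_refl, apply_apply, A1, he, B3, foldl_refl, hstr', A2]
  have hmaps_pq : ∀ s τ, s ≤ h → τ ≤ h → Set.MapsTo (Fp s τ) ↑(Dpq (s, τ)) ↑(Cpq s τ) := by
    intro s τ hs hτ p hp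
    rw [Finset.mem_coe, hDpq, Finset.mem_filter] at hp
    obtain ⟨hpT, he⟩ := hp
    obtain ⟨-, -, hstr, hS, -, -⟩ := hT p hpT
    have hstr' : μ c (p.2.foldl (fun v b => μ b v) (μ c p.1)) = p.2.foldl (fun v b => μ b v) p.1 := by
      rw [← hstr, apply_apply]
    obtain ⟨r1, r2, r3, r4⟩ := pieces p hpT s τ hs hτ
    obtain ⟨A1, A2, A3⟩ := key p hpT s τ hs hτ p.1
    obtain ⟨B1, B2, B3⟩ := key p hpT s τ hs hτ (μ c p.1)
    refine hCpq s τ _ _ _ _ _ ?_ r1 r2 r3 r4 ?_ ?_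
    · exact (hS s (Finset.mem_range.2 (by omega))).1
    · rw [A1, he, B3, foldl_refl, hstr', A2]
    · rw [foldl_refl, B1, he, B3, B2]
  have hmaps_qp : ∀ s τ, s ≤ h → τ ≤ h → Set.MapsTo (Fq s τ) ↑(Dqp (s, τ)) ↑(Cpq s τ) := by
    intro s τ hs hτ p hp
    rw [Finset.mem_coe, hDqp, Finset.mem_filter] at hp
    obtain ⟨hpT, he⟩ := hp
    obtain ⟨-, -, hstr, hS, -, -⟩ := hT p hpT
    obtain ⟨r1, r2, r3, r4⟩ := pieces p hpT s τ hs hτ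
    obtain ⟨A1, A2, A3⟩ := key p hpT s τ hs hτ p.1
    obtain ⟨B1, B2, B3⟩ := key p hpT s τ hs hτ (μ c p.1)
    refine hCpq s τ _ _ _ _ _ ?_ r1 r2 r3 r4 ?_ ?_
    · exact (hS s (Finset.mem_range.2 (by omega))).2
    · rw [B1, he, A3, foldl_refl, hstr, B2]
    · rw [foldl_refl, apply_apply, A1, he, A3, A2]
  -- cover: an unclean half-clean structure has a mutual defect at some `(s, τ) ≠ (0, 0)`, `s, τ < h`
  have hcover : T.filter (fun p => ¬ clean p) ⊆ ((Finset.range h ×ˢ Finset.range h).filter (fun st => ¬ (st.1 = 0 ∧ st.2 = 0))).biUnion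
      (fun st => Dpp st ∪ Dqq st ∪ Dpq st ∪ Dqp st) := by
    intro p hp
    rw [Finset.mem_filter] at hp
    obtain ⟨hpT, hnc⟩ := hp
    obtain ⟨hl, hch, hstr, -, hc1, hc2⟩ := hT p hpT
    have hnot := mt (hclean p) hnc
    push Not at hnot
    obtain ⟨s₀, hs₀, t₀, ht₀, e1, e2, e3⟩ := hnot
    rw [Finset.mem_range] at hs₀ ht₀
    -- a non-allowed pair is a coincidence
    have hco : ((p.2).take s₀).foldl (fun v b => μ b v) p.1 = ((p.2).take t₀).foldl (fun v b => μ b v) p.1 ∨ ((p.2).take s₀).foldl (fun v b => μ b v) (μ c p.1) = ((p.2).take t₀).foldl (fun v b => μ b v) (μ c p.1) ∨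
        ((p.2).take s₀).foldl (fun v b => μ b v) p.1 = ((p.2).take t₀).foldl (fun v b => μ b v) (μ c p.1) ∨ ((p.2).take s₀).foldl (fun v b => μ b v) (μ c p.1) = ((p.2).take t₀).foldl (fun v b => μ b v) p.1 := by
      by_contra hh
      push Not at hh
      exact absurd (e3 hh.1 hh.2.2.1 hh.2.2.2) hh.2.1
    have hne : s₀ ≠ t₀ := by
      rintro rfl
      exact e1 rfl rfl
    -- half-cleanness forces the two positions into different halves
    have hnot1 : ¬ (s₀ ≤ h ∧ t₀ ≤ h) := by
      rintro ⟨h1, h2⟩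
      have := hc1 s₀ (Finset.mem_range.2 (by omega)) t₀ (Finset.mem_range.2 (by omega))
      rcases this with ⟨a1, a2⟩ | ⟨a1, a2⟩ | ⟨a1, a2, a3, a4⟩
      · exact e1 a1 a2
      · exact e2 a1 a2
      · exact a4 (e3 a1 a2 a3)
    have hnot2 : ¬ (h ≤ s₀ ∧ h ≤ t₀) := by
      rintro ⟨h1, h2⟩
      have := hc2 (s₀ - h) (Finset.mem_range.2 (by omega)) (t₀ - h) (Finset.mem_range.2 (by omega))
      rw [show h + (s₀ - h) = s₀ by omega, show h + (t₀ - h) = t₀ by omega] at this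
      rcases this with ⟨a1, a2⟩ | ⟨a1, a2⟩ | ⟨a1, a2, a3, a4⟩
      · exact e1 a1 a2
      · exact e2 a1 a2
      · exact a4 (e3 a1 a2 a3)
    -- the end rungs are `c`-edges: `(0, 2h)` and `(2h, 0)` are allowed
    have hends : ∀ u v : Fin n, (u = v ∧ μ c u = μ c v) ∨ (u = μ c v ∧ μ c u = v) ∨
        (u ≠ v ∧ u ≠ μ c v ∧ μ c u ≠ v ∧ μ c u ≠ μ c v) := by
      intro u v
      by_cases h1 : u = v
      · exact Or.inl ⟨h1, by rw [h1]⟩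
      by_cases h2 : u = μ c v
      · exact Or.inr (Or.inl ⟨h2, by rw [h2, apply_apply]⟩)
      refine Or.inr (Or.inr ⟨h1, h2, fun h3 => h2 ?_, fun h4 => h1 ((μ c).injective h4)⟩)
      rw [← h3, apply_apply]
    have c0 : ((p.2).take 0).foldl (fun v b => μ b v) p.1 = p.1 := rfl
    have c0' : ((p.2).take 0).foldl (fun v b => μ b v) (μ c p.1) = μ c p.1 := rfl
    have c2 : ((p.2).take (2 * h)).foldl (fun v b => μ b v) p.1 = p.2.foldl (fun v b => μ b v) p.1 := by
      rw [List.take_of_length_le (by omega)]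
    have c2' : ((p.2).take (2 * h)).foldl (fun v b => μ b v) (μ c p.1) = μ c (p.2.foldl (fun v b => μ b v) p.1) := by
      rw [List.take_of_length_le (by omega), hstr]
    have hnot3 : ¬ (s₀ = 0 ∧ t₀ = 2 * h) := by
      rintro ⟨rfl, rfl⟩
      simp only [c0, c0', c2, c2'] at e1 e2 e3
      rcases hends p.1 (p.2.foldl (fun v b => μ b v) p.1) with ⟨a1, a2⟩ | ⟨a1, a2⟩ | ⟨a1, a2, a3, a4⟩
      · exact e1 a1 a2
      · exact e2 a1 a2
      · exact a4 (e3 a1 a2 a3)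
    have hnot4 : ¬ (s₀ = 2 * h ∧ t₀ = 0) := by
      rintro ⟨rfl, rfl⟩
      simp only [c0, c0', c2, c2'] at e1 e2 e3
      rcases hends (p.2.foldl (fun v b => μ b v) p.1) p.1 with ⟨a1, a2⟩ | ⟨a1, a2⟩ | ⟨a1, a2, a3, a4⟩
      · exact e1 a1 a2
      · exact e2 a1 a2
      · exact a4 (e3 a1 a2 a3)
    -- orient: `s < h < t`
    rw [Finset.mem_biUnion]
    rcases Nat.lt_or_gt_of_ne hne with hlt | hgt
    · -- `s₀ < h < t₀`
      have hs : s₀ < h := by omega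
      have ht : h < t₀ := by omega
      refine ⟨(s₀, 2 * h - t₀), Finset.mem_filter.2 ⟨Finset.mem_product.2 ⟨Finset.mem_range.2 hs,
        Finset.mem_range.2 (by omega)⟩, fun hh => hnot3 ⟨hh.1, by omega⟩⟩, ?_⟩
      have et : 2 * h - (2 * h - t₀) = t₀ := by omega
      simp only [Finset.mem_union, hDpp, hDqq, hDpq, hDqp, Finset.mem_filter, et]
      rcases hco with e | e | e | e
      · exact Or.inl (Or.inl (Or.inl ⟨hpT, e⟩))
      · exact Or.inl (Or.inl (Or.inr ⟨hpT, e⟩))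
      · exact Or.inl (Or.inr ⟨hpT, e⟩)
      · exact Or.inr ⟨hpT, e⟩
    · -- `t₀ < h < s₀`: swap the roles
      have ht : t₀ < h := by omega
      have hs : h < s₀ := by omega
      refine ⟨(t₀, 2 * h - s₀), Finset.mem_filter.2 ⟨Finset.mem_product.2 ⟨Finset.mem_range.2 ht,
        Finset.mem_range.2 (by omega)⟩, fun hh => hnot4 ⟨by omega, hh.1⟩⟩, ?_⟩
      have es : 2 * h - (2 * h - s₀) = s₀ := by omega
      simp only [Finset.mem_union, hDpp, hDqq, hDpq, hDqp, Finset.mem_filter, es]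
      rcases hco with e | e | e | e
      · exact Or.inl (Or.inl (Or.inl ⟨hpT, e.symm⟩))
      · exact Or.inl (Or.inl (Or.inr ⟨hpT, e.symm⟩))
      · exact Or.inr ⟨hpT, e.symm⟩
      · exact Or.inl (Or.inr ⟨hpT, e.symm⟩)
  -- count
  have hsplit := Finset.card_filter_add_card_filter_not (s := T) clean
  have hrest : (T.filter (fun p => ¬ clean p)).card ≤ ∑ s ∈ Finset.range h, ∑ τ ∈ Finset.range h,
      (if s = 0 ∧ τ = 0 then 0 else 2 * ((Cpp s τ).card + (Cpq s τ).card)) := by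
    refine (Finset.card_le_card hcover).trans (Finset.card_biUnion_le.trans ?_)
    rw [Finset.sum_filter, ← Finset.sum_product']
    refine Finset.sum_le_sum (fun st hst => ?_)
    rw [Finset.mem_product, Finset.mem_range, Finset.mem_range] at hst
    by_cases h0 : st.1 = 0 ∧ st.2 = 0
    · rw [if_neg (not_not_intro h0), if_pos h0]
    · rw [if_pos h0, if_neg h0]
      have hs : st.1 ≤ h := by omega
      have hτ : st.2 ≤ h := by omega
      have c1 := Finset.card_le_card_of_injOn _ (hmaps_pp st.1 st.2 hs hτ)
        ((hinjp st.1 st.2 hs).mono (Finset.coe_subset.2 (Finset.filter_subset _ _)))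
      have c2 := Finset.card_le_card_of_injOn _ (hmaps_qq st.1 st.2 hs hτ)
        ((hinjq st.1 st.2 hs).mono (Finset.coe_subset.2 (Finset.filter_subset _ _)))
      have c3 := Finset.card_le_card_of_injOn _ (hmaps_pq st.1 st.2 hs hτ)
        ((hinjp st.1 st.2 hs).mono (Finset.coe_subset.2 (Finset.filter_subset _ _)))
      have c4 := Finset.card_le_card_of_injOn _ (hmaps_qp st.1 st.2 hs hτ)
        ((hinjq st.1 st.2 hs).mono (Finset.coe_subset.2 (Finset.filter_subset _ _)))
      calc (Dpp st ∪ Dqq st ∪ Dpq st ∪ Dqp st).card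
          ≤ (Dpp st).card + (Dqq st).card + (Dpq st).card + (Dqp st).card := by
            refine (Finset.card_union_le _ _).trans (Nat.add_le_add_right ?_ _)
            refine (Finset.card_union_le _ _).trans (Nat.add_le_add_right ?_ _)
            exact Finset.card_union_le _ _
        _ ≤ (Cpp st.1 st.2).card + (Cpp st.1 st.2).card + (Cpq st.1 st.2).card + (Cpq st.1 st.2).card :=
            Nat.add_le_add (Nat.add_le_add (Nat.add_le_add c1 c2) c3) c4
        _ = 2 * ((Cpp st.1 st.2).card + (Cpq st.1 st.2).card) := by ring
  omega

/-- **Registered form** (`stub_mutualDefectsAvoiding`, a `--supports` sub-goal of crux `stmt-MatrixMultiplication-10883`, helper for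
the open core `stub_poorRigidCore`): `card_le_clean_add_mutual_avoiding`, fully quantified — the forbidden-set refinement of
`stub_mutualDefects` (p117140): members avoid `S`, containers need only the tuples with `P ∉ S`. -/
theorem stub_mutualDefectsAvoiding : ∀ (n h : ℕ) (μ : Fin 3 → Equiv.Perm (Fin n)), let f : Fin n → Fin 3 → Fin n := fun v b => μ b v; ∀ (c : Fin 3) (S : Finset (Fin n)) (red : ℕ → Finset (List (Fin 3))) (T : Finset (Fin n × List (Fin 3))) (clean : Fin n × List (Fin 3) → Prop) [DecidablePred clean] (Cpp Cpq : ℕ → ℕ → Finset (Fin n × List (Fin 3) × List (Fin 3) × List (Fin 3) × List (Fin 3))), (∀ b, μ b * μ b = 1) → (∀ m w, w.length = m → List.IsChain (· ≠ ·) w → w ∈ red m) → (∀ p ∈ T, p.2.length = 2 * h ∧ List.IsChain (· ≠ ·) p.2 ∧ μ c (p.2.foldl f p.1) = p.2.foldl f (μ c p.1) ∧ (∀ t ∈ Finset.range (2 * h + 1), (p.2.take t).foldl f p.1 ∉ S ∧ (p.2.take t).foldl f (μ c p.1) ∉ S) ∧ (∀ s ∈ Finset.range (h + 1), ∀ t ∈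 Finset.range (h + 1), ((((p.2).take s).foldl f p.1 = ((p.2).take t).foldl f p.1 ∧ ((p.2).take s).foldl f (μ c p.1) = ((p.2).take t).foldl f (μ c p.1)) ∨ (((p.2).take s).foldl f p.1 = ((p.2).take t).foldl f (μ c p.1) ∧ ((p.2).take s).foldl f (μ c p.1) = ((p.2).take t).foldl f p.1) ∨ (((p.2).take s).foldl f p.1 ≠ ((p.2).take t).foldl f p.1 ∧ ((p.2).take s).foldl f p.1 ≠ ((p.2).take t).foldl f (μ c p.1) ∧ ((p.2).take s).foldl f (μ c p.1) ≠ ((p.2).take t).foldl f p.1 ∧ ((p.2).take s).foldl f (μ c p.1) ≠ ((p.2).take t).foldl f (μ c p.1)))) ∧ (∀ s ∈ Finset.range (h + 1), ∀ t ∈ Finset.range (h + 1), ((((p.2).take (h + s)).foldl f p.1 = ((p.2).take (h + t)).foldl f p.1 ∧ ((p.2).take (h + s)).foldl f (μ c p.1) = ((p.2).take (h + t)).foldl f (μ c p.1)) ∨ (((p.2).take (h + s)).foldl f p.1 = ((p.2).take (h + t)).foldl f (μ c p.1) ∧ ((p.2).take (h + s)).foldl f (μ c p.1) = ((p.2).take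 (h + t)).foldl f p.1) ∨ (((p.2).take (h + s)).foldl f p.1 ≠ ((p.2).take (h + t)).foldl f p.1 ∧ ((p.2).take (h + s)).foldl f p.1 ≠ ((p.2).take (h + t)).foldl f (μ c p.1) ∧ ((p.2).take (h + s)).foldl f (μ c p.1) ≠ ((p.2).take (h + t)).foldl f p.1 ∧ ((p.2).take (h + s)).foldl f (μ c p.1) ≠ ((p.2).take (h + t)).foldl f (μ c p.1))))) → (∀ p : Fin n × List (Fin 3), (∀ s ∈ Finset.range (2 * h + 1), ∀ t ∈ Finset.range (2 * h + 1), ((((p.2).take s).foldl f p.1 = ((p.2).take t).foldl f p.1 ∧ ((p.2).take s).foldl f (μ c p.1) = ((p.2).take t).foldl f (μ c p.1)) ∨ (((p.2).take s).foldl f p.1 = ((p.2).take t).foldl f (μ c p.1) ∧ ((p.2).take s).foldl f (μ c p.1) = ((p.2).take t).foldl f p.1) ∨ (((p.2).take s).foldl f p.1 ≠ ((p.2).take t).foldl f p.1 ∧ ((p.2).take s).foldl f p.1 ≠ ((p.2).take t).foldl f (μ c p.1) ∧ ((p.2).take s).foldl f (μ c p.1) ≠ ((p.2).take t).foldl f p.1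 ∧ ((p.2).take s).foldl f (μ c p.1) ≠ ((p.2).take t).foldl f (μ c p.1)))) → clean p) → (∀ (s τ : ℕ) (P : Fin n) (α α' x x' : List (Fin 3)), P ∉ S → α ∈ red s → α' ∈ red τ → x ∈ red (h - s) → x' ∈ red (h - τ) → x.foldl f P = x'.foldl f P → x.foldl f (((α).reverse ++ c :: α).foldl f P) = x'.foldl f (((α').reverse ++ c :: α').foldl f P) → (P, α, α', x, x') ∈ Cpp s τ) → (∀ (s τ : ℕ) (P : Fin n) (α α' x x' : List (Fin 3)), P ∉ S → α ∈ red s → α' ∈ red τ → x ∈ red (h - s) → x' ∈ red (h - τ) → x.foldl f P = x'.foldl f (((α').reverse ++ c :: α').foldl f P) → x.foldl f (((α).reverse ++ c :: α).foldl f P) = x'.foldl f P → (P, α, α', x, x') ∈ Cpq s τ) → T.card ≤ (T.filter clean).card + ∑ s ∈ Finset.range h, ∑ τ ∈ Finset.range h, (if s = 0 ∧ τ = 0 then 0 else 2 * ((Cpp s τ).card + (Cpq s τ).card)) := by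
  intro n h μ f c S red T clean _ Cpp Cpq hμ hred hT hclean hCpp hCpq
  exact card_le_clean_add_mutual_avoiding μ c hμ h S red hred T hT clean hclean Cpp Cpq hCpp hCpq

end Summit.MatrixMultiplication.MatrixMultiplication.Theorems.HyperoctahedralThreshold.MutualDefectsAvoiding
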